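import Mathlib
import Summits.Ventures.PercRepro2.TB14SlideKernels
import Summits.Ventures.PercRepro2.TB14MarkEdge
import Summits.Ventures.PercRepro2.TB14OppRootEdge

/-!
# The edges from a mark to the avoided root are invisible (typed BHK 1.3): Theorem R
(blind cell PercRepro2, mine-c g18, 2026-08-25; `proofs/MINEC-TB14BLOCK.md` §12.10)

For the typed BHK 1.3 kernel `foldK13 = 1_Q(y) 1_Q(w) 1[x ∈ C_y(a₂)] (1[o ∈ C_y(a₂)] − 1[o ∈ C_w(a₂)])`
(root `a₂`, avoided root `a₁`), a free edge from either mark to the avoided root changes nothing: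
splitting the two-copy sum on the edge (`pairCount_split_edge`, valid for every kernel and every
free edge) gives the defect `Φ (y₂[e ↦ 1]) w₂ + Φ y₂ (w₂[e ↦ 1]) − Φ y₂ w₂`, which VANISHES
POINTWISE for `e = o a₁` (`edgeDefect_foldK13_oa₁`: in either copy the opened edge can only help
the root `a₂` reach `o` through `a₁`, which the separation forbids) and is ANTISYMMETRIC under the
exchange of the two copies for `e = x a₁` (`edgeDefect_foldK13_xa₁`), so its count is `0`.  Hence
(`pairCount_foldK13_avoidEdge_o`, `pairCount_foldK13_avoidEdge_x`)

  `S₁₃(G; a₂; x, o | a₁) = S₁₃(G − e; a₂; x, o | a₁)`   for `e = o a₁` and for `e = x a₁`,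

at every profile in which `e` is free: the core of `(TB13)_sv` has no mark–avoid edge (Theorem K′
of g17 — the sliding of a degree-two mark adjacent to the avoided root — is the case of a pendant
mark after the deletion).  Exact check `data/mine-c/g18/scripts/tb13inv.c` (every avoid set,
n ≤ 7 m ≤ 9: 890,240 + 890,240 instances, 0 failures).  Own work; standard axioms.
-/

namespace Summit.Ventures.PercRepro2

namespace TB14Cut

open CovForm A3InactiveTyped

section AvoidEdge

variable {V : Type} {E : Type} [Fintype E] [DecidableEq E] {R : Type*} [Field R]
variable {ends : E → Sym2 V} {e : E} {a₁ a₂ x o : V}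

/-- The defect of a kernel `Φ` at a free edge `e`, at the profile in which `e` is closed. -/
noncomputable def edgeDefect (Φ : Config E → Config E → R) (e : E) : Config E → Config E → R :=
  fun y₂ w₂ => Φ (Function.update y₂ e true) w₂ + Φ y₂ (Function.update w₂ e true) - Φ y₂ w₂

/-- **Splitting a two-copy count on a free edge** (every kernel): the count at a profile in which
`e` is free is the count with `e` closed plus the count of the defect. -/
theorem pairCount_split_edge (Φ : Config E → Config E → R) (F : Finset E) (z : Config E)
    (heF : e ∈ F) :
    pairCount F z Φ =
      pairCount (F.erase e) (Function.update z e false) Φ +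
        pairCount (F.erase e) (Function.update z e false) (edgeDefect Φ e) := by
  classical
  unfold pairCount
  rw [sum_admissible_split heF, ← Finset.sum_add_distrib]
  refine Finset.sum_congr rfl fun y₂ _ => ?_
  by_cases hadm : ∀ f, f ∉ F.erase e → y₂ f = Function.update z e false f
  · rw [if_pos hadm, if_pos hadm, if_pos hadm]
    have hy₂ : y₂ e = false := by
      have := hadm e (Finset.notMem_erase e F)
      rwa [Function.update_self] at this
    have hself : Function.update y₂ e false = y₂ := by
      rw [← hy₂]; exact Function.update_eq_self e y₂
    have hflip₀ : A3InactiveTyped.flipOn F y₂ =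
        Function.update (A3InactiveTyped.flipOn (F.erase e) y₂) e true := by
      funext f
      by_cases hf : f = e
      · subst hf
        rw [A3InactiveTyped.flipOn_of_mem heF, hy₂, Function.update_self]; rfl
      · rw [Function.update_of_ne hf]
        by_cases hfF : f ∈ F
        · rw [A3InactiveTyped.flipOn_of_mem hfF,
            A3InactiveTyped.flipOn_of_mem (Finset.mem_erase.2 ⟨hf, hfF⟩)]
        · rw [A3InactiveTyped.flipOn_of_notMem hfF,
            A3InactiveTyped.flipOn_of_notMem (fun h => hfF (Finset.mem_of_mem_erase h))]
    have hflip₁ : A3InactiveTyped.flipOn F (Function.update y₂ e true) =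
        A3InactiveTyped.flipOn (F.erase e) y₂ := by
      funext f
      by_cases hf : f = e
      · subst hf
        rw [A3InactiveTyped.flipOn_of_mem heF, Function.update_self,
          A3InactiveTyped.flipOn_of_notMem (Finset.notMem_erase f F)]
        exact hy₂.symm
      · by_cases hfF : f ∈ F
        · rw [A3InactiveTyped.flipOn_of_mem hfF,
            A3InactiveTyped.flipOn_of_mem (Finset.mem_erase.2 ⟨hf, hfF⟩), Function.update_of_ne hf]
        · rw [A3InactiveTyped.flipOn_of_notMem hfF,
            A3InactiveTyped.flipOn_of_notMem (fun h => hfF (Finset.mem_of_mem_erase h)),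
            Function.update_of_ne hf]
    rw [hself, hflip₀, hflip₁]
    simp only [edgeDefect]
    ring
  · rw [if_neg hadm, if_neg hadm, if_neg hadm, add_zero]

omit [Fintype E] in
/-- The Boolean core for the edge `o a₁`: the defect vanishes.  `A1 = a₁ ↔_y a₂`, `A2 = a₁ ↔_w a₂`,
`A5 = a₂ ↔_y x`, `A6 = a₂ ↔_y o`, `A8 = a₂ ↔_w o`; `R1 = a₁ ↔_y x`, `R2 = o ↔_y x`. -/
lemma avoidEdge_key_o (A1 A2 A5 A6 A8 R1 R2 : Prop) [Decidable A1] [Decidable A2] [Decidable A5]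
    [Decidable A6] [Decidable A8] [Decidable R1] [Decidable R2] :
    (if A1 ∨ A6 then (0 : R) else 1) * (if A2 then 0 else 1) *
          (if A5 ∨ (A6 ∧ R1) ∨ (A1 ∧ R2) then 1 else 0) *
          ((if A6 ∨ A1 then 1 else 0) - (if A8 then 1 else 0)) +
        (if A1 then 0 else 1) * (if A2 ∨ A8 then 0 else 1) * (if A5 then 1 else 0) *
          ((if A6 then 1 else 0) - (if A8 ∨ A2 then 1 else 0)) -
        (if A1 then 0 else 1) * (if A2 then 0 else 1) * (if A5 then 1 else 0) *
          ((if A6 then 1 else 0) - (if A8 then 1 else 0)) = 0 := by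
  by_cases hA1 : A1
  · simp [hA1]
  by_cases hA2 : A2
  · simp [hA2]
  by_cases hA6 : A6
  · by_cases hA8 : A8
    · simp [hA1, hA2, hA6, hA8]
    · simp [hA1, hA2, hA6, hA8]
  · by_cases hA8 : A8
    · simp [hA1, hA2, hA6, hA8]
    · simp [hA1, hA2, hA6, hA8]

omit [Fintype E] in
/-- **The edge `o a₁` is invisible pointwise.** -/
lemma edgeDefect_foldK13_oa₁ (he : ends e = s(o, a₁)) (y₂ w₂ : Config E) (hy : y₂ e = false)
    (hw : w₂ e = false) :
    (edgeDefect (foldK13 ends a₁ a₂ x o : Config E → Config E → R) e y₂ w₂) = 0 := by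
  classical
  have hy' := conn_update_true_iff (ends := ends) he hy
  have hw' := conn_update_true_iff (ends := ends) he hw
  have hQy' : Conn ends (Function.update y₂ e true) a₁ a₂ ↔
      Conn ends y₂ a₁ a₂ ∨ Conn ends y₂ a₂ o := by
    rw [hy' a₁ a₂]
    constructor
    · rintro (h | ⟨h1, h2⟩ | ⟨_, h2⟩)
      · exact Or.inl h
      · exact Or.inl h2
      · exact Or.inr (conn_symm h2)
    · rintro (h | h)
      · exact Or.inl h
      · exact Or.inr (Or.inr ⟨conn_refl _ _ _, conn_symm h⟩)
  have hHy' : Conn ends (Function.update y₂ e true) a₂ o ↔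
      Conn ends y₂ a₂ o ∨ Conn ends y₂ a₁ a₂ := by
    rw [hy' a₂ o]
    constructor
    · rintro (h | ⟨h1, _⟩ | ⟨h1, _⟩)
      · exact Or.inl h
      · exact Or.inl h1
      · exact Or.inr (conn_symm h1)
    · rintro (h | h)
      · exact Or.inl h
      · exact Or.inr (Or.inr ⟨conn_symm h, conn_refl _ _ _⟩)
  have hQw' : Conn ends (Function.update w₂ e true) a₁ a₂ ↔
      Conn ends w₂ a₁ a₂ ∨ Conn ends w₂ a₂ o := by
    rw [hw' a₁ a₂]
    constructor
    · rintro (h | ⟨h1, h2⟩ | ⟨_, h2⟩)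
      · exact Or.inl h
      · exact Or.inl h2
      · exact Or.inr (conn_symm h2)
    · rintro (h | h)
      · exact Or.inl h
      · exact Or.inr (Or.inr ⟨conn_refl _ _ _, conn_symm h⟩)
  have hPy' : Conn ends (Function.update y₂ e true) a₂ x ↔
      Conn ends y₂ a₂ x ∨ (Conn ends y₂ a₂ o ∧ Conn ends y₂ a₁ x) ∨
        (Conn ends y₂ a₁ a₂ ∧ Conn ends y₂ o x) := by
    rw [hy' a₂ x]
    constructor
    · rintro (h | ⟨h1, h2⟩ | ⟨h1, h2⟩)
      · exact Or.inl h
      · exact Or.inr (Or.inl ⟨h1, h2⟩)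
      · exact Or.inr (Or.inr ⟨conn_symm h1, h2⟩)
    · rintro (h | ⟨h1, h2⟩ | ⟨h1, h2⟩)
      · exact Or.inl h
      · exact Or.inr (Or.inl ⟨h1, h2⟩)
      · exact Or.inr (Or.inr ⟨conn_symm h1, h2⟩)
  have hHw' : Conn ends (Function.update w₂ e true) a₂ o ↔
      Conn ends w₂ a₂ o ∨ Conn ends w₂ a₁ a₂ := by
    rw [hw' a₂ o]
    constructor
    · rintro (h | ⟨h1, _⟩ | ⟨h1, _⟩)
      · exact Or.inl h
      · exact Or.inl h1
      · exact Or.inr (conn_symm h1)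
    · rintro (h | h)
      · exact Or.inl h
      · exact Or.inr (Or.inr ⟨conn_symm h, conn_refl _ _ _⟩)
  simp only [edgeDefect, foldK13, iQ_eq_ite', iH_eq_ite', hQy', hHy', hQw', hPy', hHw']
  exact avoidEdge_key_o (Conn ends y₂ a₁ a₂) (Conn ends w₂ a₁ a₂) (Conn ends y₂ a₂ x)
    (Conn ends y₂ a₂ o) (Conn ends w₂ a₂ o) (Conn ends y₂ a₁ x) (Conn ends y₂ o x)

/-- **THEOREM R (i)**: the edge from the mark `o` to the avoided root `a₁` is invisible to the
typed BHK 1.3 count. -/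
theorem pairCount_foldK13_avoidEdge_o (he : ends e = s(o, a₁)) (F : Finset E) (z : Config E)
    (heF : e ∈ F) :
    pairCount F z (foldK13 ends a₁ a₂ x o : Config E → Config E → R) =
      pairCount (F.erase e) (Function.update z e false) (foldK13 ends a₁ a₂ x o) := by
  classical
  rw [pairCount_split_edge _ F z heF]
  have h0 : pairCount (F.erase e) (Function.update z e false)
      (edgeDefect (foldK13 ends a₁ a₂ x o : Config E → Config E → R) e) = 0 := by
    unfold pairCount
    refine Finset.sum_eq_zero fun y₂ _ => ?_
    split_ifs with hadm
    · have hy₂ : y₂ e = false := by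
        have := hadm e (Finset.notMem_erase e F)
        rwa [Function.update_self] at this
      have hw₂ : A3InactiveTyped.flipOn (F.erase e) y₂ e = false := by
        rw [A3InactiveTyped.flipOn_of_notMem (Finset.notMem_erase e F)]; exact hy₂
      exact edgeDefect_foldK13_oa₁ he y₂ _ hy₂ hw₂
    · rfl
  rw [h0, add_zero]

/-- The antisymmetric defect of the edge `x a₁`. -/
noncomputable def avoidX (ends : E → Sym2 V) (a₁ a₂ x o : V) : Config E → Config E → R :=
  fun y w => - (iQ ends a₁ a₂ y * iQ ends a₁ a₂ w * iH ends a₂ x y * iH ends a₂ x w *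
    (iH ends a₂ o y - iH ends a₂ o w))

omit [Fintype E] [DecidableEq E] in
/-- The defect of the edge `x a₁` changes sign under the exchange of the two copies. -/
lemma avoidX_swap (y w : Config E) : (avoidX ends a₁ a₂ x o w y : R) = - avoidX ends a₁ a₂ x o y w := by
  simp only [avoidX]; ring

omit [Fintype E] in
/-- The Boolean core for the edge `x a₁`: the defect is the antisymmetric kernel.  `A7 = a₂ ↔_w x`,
`P` = the (irrelevant) `a₂ ↔ o` in the first copy with the edge open, `S1 = a₁ ↔_w o`, `S2 = x ↔_w o`. -/
lemma avoidEdge_key_x (A1 A2 A5 A6 A7 A8 P S1 S2 : Prop) [Decidable A1] [Decidable A2]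
    [Decidable A5] [Decidable A6] [Decidable A7] [Decidable A8] [Decidable P] [Decidable S1]
    [Decidable S2] :
    (if A1 ∨ A5 then (0 : R) else 1) * (if A2 then 0 else 1) * (if A5 ∨ A1 then 1 else 0) *
          ((if P then 1 else 0) - (if A8 then 1 else 0)) +
        (if A1 then 0 else 1) * (if A2 ∨ A7 then 0 else 1) * (if A5 then 1 else 0) *
          ((if A6 then 1 else 0) - (if A8 ∨ (A7 ∧ S1) ∨ (A2 ∧ S2) then 1 else 0)) -
        (if A1 then 0 else 1) * (if A2 then 0 else 1) * (if A5 then 1 else 0) *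
          ((if A6 then 1 else 0) - (if A8 then 1 else 0)) =
      - ((if A1 then 0 else 1) * (if A2 then 0 else 1) * (if A5 then 1 else 0) *
          (if A7 then 1 else 0) * ((if A6 then 1 else 0) - (if A8 then 1 else 0))) := by
  by_cases hA1 : A1
  · simp [hA1]
  by_cases hA2 : A2
  · simp [hA2]
  by_cases hA5 : A5
  · by_cases hA7 : A7
    · simp [hA1, hA2, hA5, hA7]
    · simp [hA1, hA2, hA5, hA7]
  · simp [hA1, hA5]

omit [Fintype E] in
/-- **The defect of the edge `x a₁` is antisymmetric.** -/
lemma edgeDefect_foldK13_xa₁ (he : ends e = s(x, a₁)) (y₂ w₂ : Config E) (hy : y₂ e = false)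
    (hw : w₂ e = false) :
    (edgeDefect (foldK13 ends a₁ a₂ x o : Config E → Config E → R) e y₂ w₂) =
      avoidX ends a₁ a₂ x o y₂ w₂ := by
  classical
  have hy' := conn_update_true_iff (ends := ends) he hy
  have hw' := conn_update_true_iff (ends := ends) he hw
  have hQy' : Conn ends (Function.update y₂ e true) a₁ a₂ ↔
      Conn ends y₂ a₁ a₂ ∨ Conn ends y₂ a₂ x := by
    rw [hy' a₁ a₂]
    constructor
    · rintro (h | ⟨h1, h2⟩ | ⟨_, h2⟩)
      · exact Or.inl h
      · exact Or.inl h2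
      · exact Or.inr (conn_symm h2)
    · rintro (h | h)
      · exact Or.inl h
      · exact Or.inr (Or.inr ⟨conn_refl _ _ _, conn_symm h⟩)
  have hXy' : Conn ends (Function.update y₂ e true) a₂ x ↔
      Conn ends y₂ a₂ x ∨ Conn ends y₂ a₁ a₂ := by
    rw [hy' a₂ x]
    constructor
    · rintro (h | ⟨h1, _⟩ | ⟨h1, _⟩)
      · exact Or.inl h
      · exact Or.inl h1
      · exact Or.inr (conn_symm h1)
    · rintro (h | h)
      · exact Or.inl h
      · exact Or.inr (Or.inr ⟨conn_symm h, conn_refl _ _ _⟩)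
  have hQw' : Conn ends (Function.update w₂ e true) a₁ a₂ ↔
      Conn ends w₂ a₁ a₂ ∨ Conn ends w₂ a₂ x := by
    rw [hw' a₁ a₂]
    constructor
    · rintro (h | ⟨h1, h2⟩ | ⟨_, h2⟩)
      · exact Or.inl h
      · exact Or.inl h2
      · exact Or.inr (conn_symm h2)
    · rintro (h | h)
      · exact Or.inl h
      · exact Or.inr (Or.inr ⟨conn_refl _ _ _, conn_symm h⟩)
  have hHw' : Conn ends (Function.update w₂ e true) a₂ o ↔
      Conn ends w₂ a₂ o ∨ (Conn ends w₂ a₂ x ∧ Conn ends w₂ a₁ o) ∨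
        (Conn ends w₂ a₁ a₂ ∧ Conn ends w₂ x o) := by
    rw [hw' a₂ o]
    constructor
    · rintro (h | ⟨h1, h2⟩ | ⟨h1, h2⟩)
      · exact Or.inl h
      · exact Or.inr (Or.inl ⟨h1, h2⟩)
      · exact Or.inr (Or.inr ⟨conn_symm h1, h2⟩)
    · rintro (h | ⟨h1, h2⟩ | ⟨h1, h2⟩)
      · exact Or.inl h
      · exact Or.inr (Or.inl ⟨h1, h2⟩)
      · exact Or.inr (Or.inr ⟨conn_symm h1, h2⟩)
  simp only [edgeDefect, foldK13, avoidX, iQ_eq_ite', iH_eq_ite', hQy', hXy', hQw', hHw']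
  exact avoidEdge_key_x (Conn ends y₂ a₁ a₂) (Conn ends w₂ a₁ a₂) (Conn ends y₂ a₂ x)
    (Conn ends y₂ a₂ o) (Conn ends w₂ a₂ x) (Conn ends w₂ a₂ o)
    (Conn ends (Function.update y₂ e true) a₂ o) (Conn ends w₂ a₁ o) (Conn ends w₂ x o)

/-- **THEOREM R (ii)**: the edge from the mark `x` to the avoided root `a₁` is invisible to the
typed BHK 1.3 count (ordered field: the antisymmetric defect cancels). -/
theorem pairCount_foldK13_avoidEdge_x [LinearOrder R] [IsStrictOrderedRing R]
    (he : ends e = s(x, a₁)) (F : Finset E) (z : Config E) (heF : e ∈ F) :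
    pairCount F z (foldK13 ends a₁ a₂ x o : Config E → Config E → R) =
      pairCount (F.erase e) (Function.update z e false) (foldK13 ends a₁ a₂ x o) := by
  classical
  rw [pairCount_split_edge _ F z heF]
  have hX : pairCount (F.erase e) (Function.update z e false)
      (edgeDefect (foldK13 ends a₁ a₂ x o : Config E → Config E → R) e) =
      pairCount (F.erase e) (Function.update z e false) (avoidX ends a₁ a₂ x o) := by
    unfold pairCount
    refine Finset.sum_congr rfl fun y₂ _ => ?_
    split_ifs with hadm
    · have hy₂ : y₂ e = false := by
        have := hadm e (Finset.notMem_erase e F)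
        rwa [Function.update_self] at this
      have hw₂ : A3InactiveTyped.flipOn (F.erase e) y₂ e = false := by
        rw [A3InactiveTyped.flipOn_of_notMem (Finset.notMem_erase e F)]; exact hy₂
      exact edgeDefect_foldK13_xa₁ he y₂ _ hy₂ hw₂
    · rfl
  rw [hX, pairCount_antisymm_eq_zero _ _ _ (avoidX_swap (ends := ends) (a₁ := a₁) (a₂ := a₂)
    (x := x) (o := o)), add_zero]

end AvoidEdge

end TB14Cut

end Summit.Ventures.PercRepro2
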